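import Summits.CriticalPhenomena.Ising3DConformalLimit.Theses.ModularBoosts
import Summits.CriticalPhenomena.Ising3DConformalLimit.Theorems.ModularBoostsIsingLimitAxisPermutation
import HarnessLib
import HarnessLib.Audit.Check

/-!
# Birth skeleton (BC3) of crux `IsingLimitLightCone` — route ModularBoosts, item stmt-CriticalPhenomena-5430

Line `birth` = the route's own declared two-layer plan for (L) (route header, TWO-LAYER PLAN:
"IsingLimitLightCone ⇐ CausalGluingUnitSpeed → SpectralConeUnitSpeed → IsingLimitLightCone (k = 2; the natural
split fixes v = 1, the value cubic symmetry predicts, and separates locality from the spectrum condition)"),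
sharpened in two ways that the composition below discharges with tree theorems:

* the speed is PINNED to `v = 1` in both stubs (the crux only asks for SOME common `v > 0`; on the conformal
  two-point function `(‖q‖² + ζ²)^{-Δ}` clause (a) holds iff `v ≥ 1` and clause (b) iff `v ≤ 1` — route review
  2026-08-15 — so `v = 1` is the only value at which both can hold for the Ising limit, and each stub is a
  strengthening of one conjunct, not a restatement of the crux);
* the spectral cone (b) is asked ONLY for complex shifts along the axis `e₀` (`j = 0`); the case `j = 1` of the
  crux is recovered in `IsingLimitLightCone_of` from the landed support theorem
  `Theorems.isingLimitAxisPermutation_proof` (item stmt-CriticalPhenomena-5433, axis permutations pass to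
  normalised pointwise limits) applied to the coordinate swap `0 ↔ 1`, which fixes the time axis `e₂`, maps
  `e₁ ↦ e₀`, preserves the time-ordering hypothesis and `NonCoincident` (`map_mem_nonCoincident_iff`).

Stubs (each a genuine open lemma of the line, Ising-specific — the model-blind versions are not claimed):
* `stub_causalGluingUnitSpeed`  — (a) at unit speed: LOCALITY. Moving one insertion in complex `e₂`-time `ζ`
  inside a slab free of other insertion times, the correlator continues holomorphically to the slit strip
  `{|Re ζ| < R} ∖ {Re ζ = 0, |Im ζ| ≥ ‖q‖}` (`q` = horizontal offset to its partner): Glimm–Jaffe Prop. 19.5.7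
  at `v = 1`, to be obtained WITHOUT the rotation axiom (intended source: reflection positivity in the nine
  lattice mirrors + one-variable Stieltjes/Widder structure + edge-of-the-wedge / Painlevé gluing across the
  spacelike window).
* `stub_spectralConeUnitSpeedAxis0` — (b) at unit speed along `e₀`: SPECTRUM CONDITION `H ≥ |P₀|`. A
  time-separated block shifted by complex time gap `ζ` and complex spatial shift `β e₀` is jointly holomorphic on
  the cone `{Re ζ > -g, |Im β| < Re ζ + g}`: Glimm–Jaffe Cor. 19.5.4 / Thm 19.5.5 at `v = 1`, again to be
  obtained without rotations (intended source, route header: RP in the nine lattice mirrors — the diagonal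
  mirrors `x₀ = ±x₂` are the ones coupling the `e₀`-shift to the `e₂`-time — + one-variable Stieltjes/Widder
  structure + separate-to-joint analyticity).

Composition: `IsingLimitLightCone_of : __Registered.stub_causalGluingUnitSpeed →
__Registered.stub_spectralConeUnitSpeedAxis0 → Theses.ModularBoosts.IsingLimitLightCone` (sorry-free; `v := 1`,
`div_one`/`one_mul`, `j = 0 ∨ j = 1` by `decide`, the `j = 1` case transported by the swap `0 ↔ 1`), and
`isingLimitLightCone_skeleton` applies it to the two `stub_…` literally (which checks that statements, aliases
and stubs agree). Device `__Registered` as in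
`Summits/CriticalPhenomena/CardyFormulaZ2/Cruxes/LoopsToCrossings/Lines/br-sandwich-diagonal.lean`: the hypotheses
of `_of` are admissible BY NAME for `#h21_check_skeleton`; the namespace is an implementation detail.

Disproof used: none — `ledger crux ls stmt-CriticalPhenomena-5430` lists no `Disproof.lean` and no landed
`Theorems/IsingLimitLightCone/Negative/*` (2026-08-17); negatives index of the summit has no light-cone statement.
-/

noncomputable section

namespace Summit.CriticalPhenomena.Ising3DConformalLimit.Cruxes.IsingLimitLightCone.Birth

open Literature.Probability.LatticeModels
open Summit.CriticalPhenomena.Ising3DConformalLimit.MoebiusLimitExistsNegative (map_mem_nonCoincident_iff)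

/-! ### The two statements of the line -/

/-- STATEMENT A — causal slit-gluing at unit speed (clause (a) of the crux with `v = 1`). -/
def CausalGluingUnitSpeed : Prop :=
  ∀ (ρ : ℝ → ℝ) (Δ : ℝ) (S : CorrFamily 3), (∀ δ ∈ Set.Ioc (0:ℝ) 1, 0 < ρ δ) →
    HasPointwiseScalingLimit (criticalCorr 3) ρ S →
    (∀ n z, z ∉ NonCoincident 3 n → S n z = 0) → IsNondegenerateTwoPoint S →
    IsTranslationInvariant S → IsScaleCovariant Δ S →
    ∀ (n : ℕ) (p q : EuclideanSpace ℝ (Fin 3)) (x : Fin n → EuclideanSpace ℝ (Fin 3)) (R : ℝ),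
      0 < R → q ≠ 0 → q 2 = 0 → (∀ i, R < |x i 2 - p 2|) →
      Matrix.vecCons (p + q) (Matrix.vecCons p x) ∈ NonCoincident 3 (n + 1 + 1) →
      ∃ Φ : ℂ → ℂ, DifferentiableOn ℂ Φ {ζ : ℂ | |ζ.re| < R ∧ (ζ.re ≠ 0 ∨ |ζ.im| < ‖q‖)} ∧
        ∀ s : ℝ, |s| < R → Φ (s : ℂ) =
          (S (n + 1 + 1) (Matrix.vecCons (p + q + s • EuclideanSpace.single 2 (1:ℝ))
            (Matrix.vecCons p x)) : ℂ)

/-- STATEMENT B — spectral cone at unit speed along the axis `e₀` (clause (b) of the crux with `v = 1`,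
`j = 0`). -/
def SpectralConeUnitSpeedAxis0 : Prop :=
  ∀ (ρ : ℝ → ℝ) (Δ : ℝ) (S : CorrFamily 3), (∀ δ ∈ Set.Ioc (0:ℝ) 1, 0 < ρ δ) →
    HasPointwiseScalingLimit (criticalCorr 3) ρ S →
    (∀ n z, z ∉ NonCoincident 3 n → S n z = 0) → IsNondegenerateTwoPoint S →
    IsTranslationInvariant S → IsScaleCovariant Δ S →
    ∀ (m k : ℕ) (x : Fin m → EuclideanSpace ℝ (Fin 3)) (y : Fin k → EuclideanSpace ℝ (Fin 3)) (g : ℝ),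
      0 < g → (∀ a b, x a 2 + g ≤ y b 2) → Fin.append x y ∈ NonCoincident 3 (m + k) →
      ∃ Φ : ℂ × ℂ → ℂ, DifferentiableOn ℂ Φ {w : ℂ × ℂ | -g < w.1.re ∧ |w.2.im| < w.1.re + g} ∧
        ∀ s b : ℝ, -g < s → Φ ((s : ℂ), (b : ℂ)) =
          (S (m + k) (Fin.append x (fun i => y i + s • EuclideanSpace.single 2 (1:ℝ) +
            b • EuclideanSpace.single 0 (1:ℝ))) : ℂ)

/-! ### The registered stubs (the only `sorry`s of the file; statements restated verbatim) -/

/-- STUB A (XL, Ising-specific) — `CausalGluingUnitSpeed`: for every normalised, non-degenerate,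
translation-invariant, scale-covariant pointwise scaling limit `S` of `criticalCorr 3`, clause (a) of
`IsingLimitLightCone` at speed `v = 1`: the one-insertion complex-time continuation is holomorphic on the slit
strip `{|Re ζ| < R, Re ζ ≠ 0 ∨ |Im ζ| < ‖q‖}` and restricts to the correlator on the real segment.
Glimm–Jaffe 1987 Prop. 19.5.7 gives it FROM rotations; here: nine-mirror RP + Painlevé gluing across the
spacelike window (locality half of the light cone). Why it might fail: one-directional RP gives only the two
half-strips `Re ζ ≠ 0`; the boundary values on the window must agree (spacelike commutativity), for which no
lattice derivation is known. -/
theorem stub_causalGluingUnitSpeed :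
    ∀ (ρ : ℝ → ℝ) (Δ : ℝ) (S : CorrFamily 3), (∀ δ ∈ Set.Ioc (0:ℝ) 1, 0 < ρ δ) →
      HasPointwiseScalingLimit (criticalCorr 3) ρ S →
      (∀ n z, z ∉ NonCoincident 3 n → S n z = 0) → IsNondegenerateTwoPoint S →
      IsTranslationInvariant S → IsScaleCovariant Δ S →
      ∀ (n : ℕ) (p q : EuclideanSpace ℝ (Fin 3)) (x : Fin n → EuclideanSpace ℝ (Fin 3)) (R : ℝ),
        0 < R → q ≠ 0 → q 2 = 0 → (∀ i, R < |x i 2 - p 2|) →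
        Matrix.vecCons (p + q) (Matrix.vecCons p x) ∈ NonCoincident 3 (n + 1 + 1) →
        ∃ Φ : ℂ → ℂ, DifferentiableOn ℂ Φ {ζ : ℂ | |ζ.re| < R ∧ (ζ.re ≠ 0 ∨ |ζ.im| < ‖q‖)} ∧
          ∀ s : ℝ, |s| < R → Φ (s : ℂ) =
            (S (n + 1 + 1) (Matrix.vecCons (p + q + s • EuclideanSpace.single 2 (1:ℝ))
              (Matrix.vecCons p x)) : ℂ) := by
  sorry

/-- STUB B (XL, Ising-specific) — `SpectralConeUnitSpeedAxis0`: for every such limit `S`, clause (b) of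
`IsingLimitLightCone` at speed `v = 1` for complex spatial shifts along `e₀` only: a time-separated block moved
by complex time gap `ζ` (`Re ζ > -g`) and complex shift `β e₀` is the restriction of a function holomorphic on
`{Re ζ > -g, |Im β| < Re ζ + g}` — the spectral cone `H ≥ |P₀|` of the `e₂`-reconstruction (Glimm–Jaffe
Cor. 19.5.4 / Thm 19.5.5 at `v = 1`, there FROM rotations). The `e₁` case follows by the axis swap (see
`IsingLimitLightCone_of`). Why it might fail: RP in `e₂` gives holomorphy in `ζ` alone and RP in the diagonal
mirrors `x₀ = ±x₂` gives one-variable positivity of the mixed transfers; joint holomorphy on the full cone at the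
SAME unit slope is a several-variables tube statement with no Lorentz group (no BHW enlargement). -/
theorem stub_spectralConeUnitSpeedAxis0 :
    ∀ (ρ : ℝ → ℝ) (Δ : ℝ) (S : CorrFamily 3), (∀ δ ∈ Set.Ioc (0:ℝ) 1, 0 < ρ δ) →
      HasPointwiseScalingLimit (criticalCorr 3) ρ S →
      (∀ n z, z ∉ NonCoincident 3 n → S n z = 0) → IsNondegenerateTwoPoint S →
      IsTranslationInvariant S → IsScaleCovariant Δ S →
      ∀ (m k : ℕ) (x : Fin m → EuclideanSpace ℝ (Fin 3)) (y : Fin k → EuclideanSpace ℝ (Fin 3)) (g : ℝ),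
        0 < g → (∀ a b, x a 2 + g ≤ y b 2) → Fin.append x y ∈ NonCoincident 3 (m + k) →
        ∃ Φ : ℂ × ℂ → ℂ, DifferentiableOn ℂ Φ {w : ℂ × ℂ | -g < w.1.re ∧ |w.2.im| < w.1.re + g} ∧
          ∀ s b : ℝ, -g < s → Φ ((s : ℂ), (b : ℂ)) =
            (S (m + k) (Fin.append x (fun i => y i + s • EuclideanSpace.single 2 (1:ℝ) +
              b • EuclideanSpace.single 0 (1:ℝ))) : ℂ) := by
  sorry

/-! ### Aliases keyed by the registered stub names (implementation detail for the native skeleton audit) -/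
namespace __Registered

/-- Alias of `CausalGluingUnitSpeed` keyed by the registered stub name. -/
abbrev stub_causalGluingUnitSpeed : Prop := CausalGluingUnitSpeed
/-- Alias of `SpectralConeUnitSpeedAxis0` keyed by the registered stub name. -/
abbrev stub_spectralConeUnitSpeedAxis0 : Prop := SpectralConeUnitSpeedAxis0

end __Registered

/-! ### Transport lemmas for the axis swap `0 ↔ 1` (sorry-free) -/

/-- The coordinate swap `x₀ ↔ x₁` of `ℝ³` as a linear isometry. -/
abbrev swap01 : EuclideanSpace ℝ (Fin 3) ≃ₗᵢ[ℝ] EuclideanSpace ℝ (Fin 3) :=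
  LinearIsometryEquiv.piLpCongrLeft 2 ℝ ℝ (Equiv.swap (0 : Fin 3) 1)

theorem swap01_apply_two (z : EuclideanSpace ℝ (Fin 3)) : (swap01 z) 2 = z 2 := by
  simp [swap01, LinearIsometryEquiv.piLpCongrLeft_apply, Equiv.piCongrLeft'_apply,
    Equiv.swap_apply_of_ne_of_ne]

theorem swap01_single_two :
    swap01 (EuclideanSpace.single 2 (1:ℝ)) = EuclideanSpace.single 2 (1:ℝ) := by
  rw [swap01, EuclideanSpace.piLpCongrLeft_single]
  congr 1

theorem swap01_single_one :
    swap01 (EuclideanSpace.single 1 (1:ℝ)) = EuclideanSpace.single 0 (1:ℝ) := by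
  rw [swap01, EuclideanSpace.piLpCongrLeft_single]
  congr 1

/-- A map applied pointwise to an appended configuration is the append of the mapped blocks. -/
theorem map_append {α β : Type*} {m k : ℕ} (f : α → β) (x : Fin m → α) (y : Fin k → α) :
    (fun i => f (Fin.append x y i)) = Fin.append (fun a => f (x a)) (fun b => f (y b)) := by
  funext i
  refine Fin.addCases (fun a => ?_) (fun b => ?_) i
  · simp
  · simp

/-! ### The composition (kernel-checked, no `sorry`) -/

/-- **`IsingLimitLightCone` from the two stubs.** Take `v := 1`. Clause (a) is STUB A verbatim
(`‖q‖ / 1 = ‖q‖`). Clause (b): `j ≠ 2` forces `j = 0 ∨ j = 1`; `j = 0` is STUB B verbatim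
(`1 * (Re ζ + g) = Re ζ + g`); for `j = 1` apply STUB B to the swapped configuration
`(swap01 ∘ x, swap01 ∘ y)` — the swap fixes the time coordinate (time ordering kept), is injective
(`NonCoincident` kept), maps `e₂ ↦ e₂`, `e₁ ↦ e₀` — and pull the values back with the landed axis-permutation
invariance `Theorems.isingLimitAxisPermutation_proof` (item 5433) of the normalised limit `S`. -/
theorem IsingLimitLightCone_of (hA : __Registered.stub_causalGluingUnitSpeed)
    (hB : __Registered.stub_spectralConeUnitSpeedAxis0) :
    Summit.CriticalPhenomena.Ising3DConformalLimit.Theses.ModularBoosts.IsingLimitLightCone := by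
  intro ρ Δ S hρ hlim hnorm hnd htr hsc
  refine ⟨1, one_pos, ?_, ?_⟩
  · -- (a) at v = 1
    intro n p q x R hR hq hq2 hx hnc
    obtain ⟨Φ, hΦ, hΦS⟩ := hA ρ Δ S hρ hlim hnorm hnd htr hsc n p q x R hR hq hq2 hx hnc
    exact ⟨Φ, by simpa only [div_one] using hΦ, hΦS⟩
  · -- (b) at v = 1
    intro m k x y g j hj hg hxy hnc
    rcases (by decide : ∀ j : Fin 3, j ≠ 2 → j = 0 ∨ j = 1) j hj with rfl | rfl
    · -- along e₀: STUB B verbatim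
      obtain ⟨Φ, hΦ, hΦS⟩ := hB ρ Δ S hρ hlim hnorm hnd htr hsc m k x y g hg hxy hnc
      exact ⟨Φ, by simpa only [one_mul] using hΦ, hΦS⟩
    · -- along e₁: transport by the swap 0 ↔ 1
      have hperm := Theorems.isingLimitAxisPermutation_proof ρ S hρ hlim hnorm (Equiv.swap (0 : Fin 3) 1)
      have hxy' : ∀ a b, (swap01 (x a)) 2 + g ≤ (swap01 (y b)) 2 := by
        intro a b; rw [swap01_apply_two, swap01_apply_two]; exact hxy a b
      have hnc' : Fin.append (fun a => swap01 (x a)) (fun b => swap01 (y b)) ∈ NonCoincident 3 (m + k) := by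
        rw [← map_append]
        exact (map_mem_nonCoincident_iff swap01 _).2 hnc
      obtain ⟨Φ, hΦ, hΦS⟩ :=
        hB ρ Δ S hρ hlim hnorm hnd htr hsc m k (fun a => swap01 (x a)) (fun b => swap01 (y b)) g hg hxy' hnc'
      refine ⟨Φ, by simpa only [one_mul] using hΦ, fun s b hs => ?_⟩
      rw [hΦS s b hs]
      congr 1
      rw [← hperm (m + k) (Fin.append x (fun i => y i + s • EuclideanSpace.single 2 (1:ℝ) +
        b • EuclideanSpace.single 1 (1:ℝ)))]
      congr 1
      rw [map_append]
      congr 1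
      funext i
      change swap01 (y i) + _ + _ = swap01 _
      rw [map_add, map_add, map_smul, map_smul, swap01_single_two, swap01_single_one]

/-- The crux from the registered stubs (sorry-free itself; closed modulo the two `stub_…`; its type is
literally the route decl). Applying `IsingLimitLightCone_of` to the stubs checks that statements, aliases and
stubs agree. -/
theorem isingLimitLightCone_skeleton :
    Summit.CriticalPhenomena.Ising3DConformalLimit.Theses.ModularBoosts.IsingLimitLightCone :=
  IsingLimitLightCone_of stub_causalGluingUnitSpeed stub_spectralConeUnitSpeedAxis0

end Summit.CriticalPhenomena.Ising3DConformalLimit.Cruxes.IsingLimitLightCone.Birth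

end

#h21_check_skeleton "stmt-CriticalPhenomena-5430" Summit.CriticalPhenomena.Ising3DConformalLimit.Theses.ModularBoosts.IsingLimitLightCone stub_causalGluingUnitSpeed stub_spectralConeUnitSpeedAxis0
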